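import Literature.MathematicalPhysics.QuantumLattice.HubbardTTPrimeDoccTransportThermal
import HarnessLib

/-!
# The THERMAL apex row: two canonical Gibbs states at `(β_A; t, t'_A, U_A)` and `(β_P; t, t'_P, U_P)` with
# `β_A U_A = β_P U_P` compare their one-body energies at the apex hopping — the `T > 0` twin of
# `HubbardTTPrimeApexRow.lean` along rays of constant `βU`

Family `hubbard` (topic `MathematicalPhysics/QuantumLattice`); written for stage S2/S3 of the Hubbard material-oracle
programme (`T > 0` leg: the phase map's cells are `T × couplings`; seat `hubbard-downfold-unc-2`,
`prover-hubbard-downfold-unc-2-g16-0`).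

THE OBSERVATION (finite volume, exact). For Hermitian `H_A, H_P` on one space and `β_A, β_P` real, the two Peierls–Bogoliubov
tangents at `β = 1` between `β_A H_A` and `β_P H_P` add up to the CROSS inequality
`⟨β_A H_A − β_P H_P⟩_{ρ_A} ≤ ⟨β_A H_A − β_P H_P⟩_{ρ_P}`, `ρ_X` the Gibbs state of `H_X` at `β_X` — the entropies cancel exactly
as the double occupancy does in the `T = 0` apex row once `β_A U_A = β_P U_P`: for the canonical sector Hamiltonians
`H_X = H_L(t, t'_X, U_X)|_sec` (same torus, same `(N, S^z)` sector), `β_A H_A − β_P H_P = (β_A − β_P)·H_L(t, κ, 0)|_sec` with the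
apex hopping `κ = (β_A t'_A − β_P t'_P)/(β_A − β_P)` (`= (U_P t'_A − U_A t'_P)/(U_P − U_A)` when `β_X = γ/U_X`), so for `β_P < β_A`
  `⟨H_L(t,κ,0)⟩_{ρ_A} ≤ ⟨H_L(t,κ,0)⟩_{ρ_P}`.
In the torus limit (common tori, then any tori by compactness) this is `e_{Φ(t,κ,0)}(ω_A) ≤ e_{Φ(t,κ,0)}(ω_P)` for thermal torus
limits: a certified thermal FLOOR on the `κ`-hopping energy at the hotter-and-more-coupled point `P` flows to the cooler, less
coupled `A`; a CEILING on `−e_{Φ(t,κ,0)}` (the shape of a stiffness word) flows from `A` to `P`. At `t' = 0` (`κ = 0`): the kinetic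
word at `(β, U)` is a word at EVERY `(βU/U', U')`, `U' ≥ U`.

§1 finite volume: Gibbs-weight rescaling `β ↔ 1`, the cross inequality (`gibbsState_cross_re_le`), the affine decomposition
of the sector Hamiltonian, the apex comparison in mixture form (`sectorGibbs_apexHoppingMean_le`);
§2 torus limit along common tori (`IsTorusLimitOfMixture.meanEnergy_apexHopping_le_of_sectorGibbs_thermal`);
§3 along any tori: a floor word at `P` moves to `A`, a word `ℓ ≤ e_{Φ(t,κ,0)}` certified on the thermal class at `A` holds on
the thermal class at `P` (`…_of_forall_source_…`), and the `κ = 2t'_P` and `t' = 0` special cases.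

NOT said: nothing at equal `βU` but different `β` alone (the ray is one-dimensional); nothing toward smaller `U`; the
half-filling sign `t'K₂ ≤ 0` for thermal states is not used or proved here (hinges are the consumer's, with `K₂` brackets).

## Mathlib / tree search

REUSED: `log_partitionFn_sub_le_log_partitionFn_add` (Peierls–Bogoliubov), `re_gibbsState_sectorHamiltonianTT'_coupling`,
`sectorHamiltonianTT'_eq_add_smul_tPrime`, `sectorHamiltonianTT'_eq_add_smul_U`, `IsTorusLimitOfMixture.tendsto_meanEnergy_hubbardTTPrime`,
`exists_isTorusLimitOfMixture_sectorGibbs`. `lean search 'apex.*[Tt]hermal|cross.*gibbs|isoBeta'`: nothing; the tree's thermal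
transport rows are one-state (`…DiagHopTransportThermal`, `…DoccTransportThermal`, hubbard-tc's coupling dilution).

## References

* E. H. Lieb, *The classical limit of quantum spin systems*, Commun. Math. Phys. 31 (1973) 327, §V (5.2)–(5.4) (Peierls–Bogoliubov).
  [cite: Lieb1973, §V (5.2)–(5.4)]
* D. Ruelle, *Statistical Mechanics: Rigorous Results* (1969), §2.5 (Gibbs variational principle). [cite: Ruelle1969, §2.5]
* R. B. Israel, *Convexity in the Theory of Lattice Gases* (1979), Lemma II.3.1. [cite: Israel1979, Lemma II.3.1]
* T. Koma, H. Tasaki, J. Stat. Phys. 76 (1994) 745, §1. [cite: KomaTasaki1994, §1]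
-/

noncomputable section

namespace Literature.MathematicalPhysics.QuantumLattice

open Matrix Finset HubbardWave0 Literature.Probability.LatticeModels ThermodynamicLimit
open _root_.Filter
open scoped _root_.Topology ComplexOrder BigOperators

/-! ### §1 Finite volume: the cross Peierls–Bogoliubov inequality and the thermal apex comparison -/

section FiniteVolume

variable {n : ℝ}

/-- The Gibbs weight at `β` is the Gibbs weight at `1` of `β·H`. [folklore] -/
private theorem gibbsWeight_one_smul {m : Type*} [Fintype m] [DecidableEq m] (β : ℝ) (H : Matrix m m ℂ) :
    gibbsWeight 1 ((β : ℂ) • H) = gibbsWeight β H := by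
  unfold gibbsWeight
  rw [smul_smul]
  norm_num

/-- The partition function at `β` is the partition function at `1` of `β·H`. [folklore] -/
private theorem partitionFn_one_smul {m : Type*} [Fintype m] [DecidableEq m] (β : ℝ) (H : Matrix m m ℂ) :
    partitionFn 1 ((β : ℂ) • H) = partitionFn β H := by
  unfold partitionFn
  rw [gibbsWeight_one_smul]

/-- The Gibbs state at `β` is the Gibbs state at `1` of `β·H`. [folklore] -/
private theorem gibbsState_one_smul {m : Type*} [Fintype m] [DecidableEq m] (β : ℝ) (H X : Matrix m m ℂ) :
    gibbsState 1 ((β : ℂ) • H) X = gibbsState β H X := by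
  rw [gibbsState_apply, gibbsState_apply, partitionFn_one_smul, gibbsWeight_one_smul]

/-- A real multiple of a Hermitian matrix is Hermitian. [folklore] -/
private theorem isHermitian_ofReal_smul_apexT {m : Type*} {K : Matrix m m ℂ} (hK : K.IsHermitian) (c : ℝ) :
    ((c : ℂ) • K).IsHermitian := by
  rw [Matrix.IsHermitian, Matrix.conjTranspose_smul, hK.eq, Complex.star_def, Complex.conj_ofReal]

/-- **The cross Peierls–Bogoliubov inequality at two temperatures.** For Hermitian `H_A, H_P` on a nonempty finite space and
real `β_A, β_P`: `Re⟨β_A H_A − β_P H_P⟩_{β_A, H_A} ≤ Re⟨β_A H_A − β_P H_P⟩_{β_P, H_P}` — the two Peierls–Bogoliubov tangents at `β = 1`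
between `β_A H_A` and `β_P H_P` (`W = β_P H_P − β_A H_A`): `⟨W⟩_{H+W} ≤ log Z(H) − log Z(H + W) ≤ ⟨W⟩_H`.
[cite: Lieb1973, §V (5.2)–(5.4)] [cite: Ruelle1969, §2.5] -/
theorem gibbsState_cross_re_le {m : Type*} [Fintype m] [DecidableEq m] [Nonempty m] {HA HP : Matrix m m ℂ}
    (hA : HA.IsHermitian) (hP : HP.IsHermitian) (βA βP : ℝ) :
    (gibbsState βA HA ((βA : ℂ) • HA - (βP : ℂ) • HP)).re ≤
      (gibbsState βP HP ((βA : ℂ) • HA - (βP : ℂ) • HP)).re := by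
  set H : Matrix m m ℂ := (βA : ℂ) • HA with hH
  set W : Matrix m m ℂ := (βP : ℂ) • HP - (βA : ℂ) • HA with hW
  have hHh : H.IsHermitian := isHermitian_ofReal_smul_apexT hA βA
  have hWh : W.IsHermitian := (isHermitian_ofReal_smul_apexT hP βP).sub (isHermitian_ofReal_smul_apexT hA βA)
  have hHW : H + W = (βP : ℂ) • HP := by rw [hH, hW]; abel
  have h1 := log_partitionFn_sub_le_log_partitionFn_add hHh hWh 1
  have h2 := log_partitionFn_sub_le_log_partitionFn_add (hHh.add hWh) hWh.neg 1
  rw [add_neg_cancel_right, map_neg, Complex.neg_re] at h2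
  -- `⟨W⟩_{1, β_P H_P} ≤ ⟨W⟩_{1, β_A H_A}`
  have hle : (gibbsState 1 (H + W) W).re ≤ (gibbsState 1 H W).re := by linarith
  rw [hHW, hH, gibbsState_one_smul, gibbsState_one_smul] at hle
  have hneg : (βA : ℂ) • HA - (βP : ℂ) • HP = -W := by rw [hW]; abel
  rw [hneg, map_neg, map_neg, Complex.neg_re, Complex.neg_re]
  linarith

/-- **The sector Hamiltonian in coordinates**: `H_L(t,s,U)|_sec = H_L(t,0,0)|_sec + s·H_L(0,1,0)|_sec + U·H_L(0,0,1)|_sec`.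
[cite: Israel1979, Lemma II.3.1] -/
theorem sectorHamiltonianTT'_eq_coords (L : ℕ) [NeZero L] (t s U n : ℝ) :
    sectorHamiltonianTT' t s U n L = sectorHamiltonianTT' t 0 0 n L +
      ((s : ℝ) : ℂ) • sectorHamiltonianTT' 0 1 0 n L + ((U : ℝ) : ℂ) • sectorHamiltonianTT' 0 0 1 n L := by
  rw [sectorHamiltonianTT'_eq_add_smul_U L t s 0 U n, sectorHamiltonianTT'_eq_add_smul_tPrime L t 0 s 0 n, sub_zero, sub_zero]

/-- **The iso-`βU` identity**: with `β_A U_A = β_P U_P` and `κ(β_A − β_P) = β_A t'_A − β_P t'_P`,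
`β_A·H_L(t,t'_A,U_A)|_sec − β_P·H_L(t,t'_P,U_P)|_sec = (β_A − β_P)·H_L(t, κ, 0)|_sec` — the interaction drops out. [cite: KomaTasaki1994, §1] -/
theorem smul_sectorHamiltonianTT'_sub_smul_eq_apex (L : ℕ) [NeZero L] (t : ℝ) {βA βP UA UP κ t'A t'P : ℝ}
    (hκ : κ * (βA - βP) = βA * t'A - βP * t'P) (hγ : βA * UA = βP * UP) :
    (βA : ℂ) • sectorHamiltonianTT' t t'A UA n L - (βP : ℂ) • sectorHamiltonianTT' t t'P UP n L =
      ((βA - βP : ℝ) : ℂ) • sectorHamiltonianTT' t κ 0 n L := by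
  have hκ' : (κ : ℂ) * ((βA : ℂ) - (βP : ℂ)) = (βA : ℂ) * (t'A : ℂ) - (βP : ℂ) * (t'P : ℂ) := by exact_mod_cast hκ
  have hγ' : (βA : ℂ) * (UA : ℂ) = (βP : ℂ) * (UP : ℂ) := by exact_mod_cast hγ
  rw [sectorHamiltonianTT'_eq_coords L t t'A UA n, sectorHamiltonianTT'_eq_coords L t t'P UP n,
    sectorHamiltonianTT'_eq_coords L t κ 0 n]
  ext a b
  simp only [Matrix.sub_apply, Matrix.add_apply, Matrix.smul_apply, smul_eq_mul]
  push_cast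
  linear_combination (-(sectorHamiltonianTT' 0 1 0 n L a b)) * hκ' + (sectorHamiltonianTT' 0 0 1 n L a b) * hγ'

/-- **THE THERMAL APEX ROW, finite volume.** `0 ≤ n ≤ 2`, side `L`, hopping `t`; inverse temperatures `β_P < β_A` and couplings
with `β_A U_A = β_P U_P`; any `t'_A, t'_P`; `κ = (β_A t'_A − β_P t'_P)/(β_A − β_P)`. Then the canonical mixture mean of `H_L(t, κ, 0)` in
the sector Gibbs state of `H_L(t,t'_A,U_A)` at `β_A` is at most its mean in the sector Gibbs state of `H_L(t,t'_P,U_P)` at `β_P`: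
`Σ_i p^A_i Re⟨ψ^A_i, H_L(t,κ,0) ψ^A_i⟩ ≤ Σ_i p^P_i Re⟨ψ^P_i, H_L(t,κ,0) ψ^P_i⟩`. [cite: Lieb1973, §V (5.2)–(5.4)] [cite: KomaTasaki1994, §1] -/
theorem sectorGibbs_apexHoppingMean_le (hn0 : 0 ≤ n) (hn2 : n ≤ 2) (L : ℕ) [NeZero L] (t : ℝ)
    {βA βP UA UP : ℝ} (hβ : βP < βA) (hγ : βA * UA = βP * UP) (t'A t'P : ℝ) :
    ∑ i, sectorGibbsWeightTT' βA t t'A UA n L i *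
        (expect (hubbardTorusTT' L t ((βA * t'A - βP * t'P) / (βA - βP)) 0) (sectorGibbsVectorTT' t t'A UA n L i)).re ≤
      ∑ i, sectorGibbsWeightTT' βP t t'P UP n L i *
        (expect (hubbardTorusTT' L t ((βA * t'A - βP * t'P) / (βA - βP)) 0) (sectorGibbsVectorTT' t t'P UP n L i)).re := by
  haveI := nonempty_szConfig hn0 hn2 L
  have hd : 0 < βA - βP := sub_pos.2 hβ
  have hcross := gibbsState_cross_re_le (isHermitian_sectorHamiltonianTT' t t'A UA n L)
    (isHermitian_sectorHamiltonianTT' t t'P UP n L) βA βP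
  have hκ : (βA * t'A - βP * t'P) / (βA - βP) * (βA - βP) = βA * t'A - βP * t'P := div_mul_cancel₀ _ hd.ne'
  rw [smul_sectorHamiltonianTT'_sub_smul_eq_apex L t hκ hγ, map_smul, map_smul, smul_eq_mul, smul_eq_mul,
    Complex.re_ofReal_mul, Complex.re_ofReal_mul, re_gibbsState_sectorHamiltonianTT'_coupling,
    re_gibbsState_sectorHamiltonianTT'_coupling] at hcross
  exact le_of_mul_le_mul_left hcross hd

end FiniteVolume

/-! ### §2 The torus limit along common tori -/

namespace InfVolFermionState

variable {t n : ℝ}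

/-- **THE THERMAL APEX ROW in the torus limit (common tori).** `0 ≤ n ≤ 2`, `β_P < β_A`, `β_A U_A = β_P U_P`,
`κ = (β_A t'_A − β_P t'_P)/(β_A − β_P)`; `ω_A`, `ω_P` torus limits of the canonical sector Gibbs states of `H(t,t'_A,U_A)` at `β_A` and of
`H(t,t'_P,U_P)` at `β_P`, same density, along the SAME `Ls → ∞`. Then `e_{Φ(t,κ,0)}(ω_A) ≤ e_{Φ(t,κ,0)}(ω_P)`.
[cite: Lieb1973, §V (5.2)–(5.4)] [cite: Ruelle1969, §2.5] -/
theorem IsTorusLimitOfMixture.meanEnergy_apexHopping_le_of_sectorGibbs_thermal (hn0 : 0 ≤ n) (hn2 : n ≤ 2)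
    {βA βP UA UP : ℝ} (hβ : βP < βA) (hγ : βA * UA = βP * UP) (t'A t'P : ℝ)
    {ωA ωP : InfVolFermionState 2} {Ls : ℕ → ℕ}
    (hA : ωA.IsTorusLimitOfMixture (sectorGibbsCount n) (fun L => sectorGibbsWeightTT' βA t t'A UA n L)
      (fun L => sectorGibbsVectorTT' t t'A UA n L) Ls)
    (hP : ωP.IsTorusLimitOfMixture (sectorGibbsCount n) (fun L => sectorGibbsWeightTT' βP t t'P UP n L)
      (fun L => sectorGibbsVectorTT' t t'P UP n L) Ls)
    (hLs : Tendsto Ls atTop atTop) :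
    ωA.meanEnergy (hubbardTTPrimeFermionInteraction t ((βA * t'A - βP * t'P) / (βA - βP)) 0) 1 ≤
      ωP.meanEnergy (hubbardTTPrimeFermionInteraction t ((βA * t'A - βP * t'P) / (βA - βP)) 0) 1 := by
  set κ : ℝ := (βA * t'A - βP * t'P) / (βA - βP)
  refine le_of_tendsto_of_tendsto (hA.tendsto_meanEnergy_hubbardTTPrime t κ 0 hLs)
    (hP.tendsto_meanEnergy_hubbardTTPrime t κ 0 hLs) ?_
  filter_upwards [hLs.eventually_ge_atTop 1] with j hj
  haveI : NeZero (Ls j) := ⟨by omega⟩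
  have hL2 : (0 : ℝ) < (Ls j : ℝ) ^ 2 := by positivity
  have hmono := sectorGibbs_apexHoppingMean_le hn0 hn2 (Ls j) t hβ hγ t'A t'P
  have hsum : ∀ (β b V : ℝ), ∑ i, sectorGibbsWeightTT' β t b V n (Ls j) i *
      ((QuantumLattice.expect (hubbardTorusTT' (Ls j) t κ 0) (sectorGibbsVectorTT' t b V n (Ls j) i)).re /
        (Ls j : ℝ) ^ 2) =
      (∑ i, sectorGibbsWeightTT' β t b V n (Ls j) i *
        (QuantumLattice.expect (hubbardTorusTT' (Ls j) t κ 0) (sectorGibbsVectorTT' t b V n (Ls j) i)).re) /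
        (Ls j : ℝ) ^ 2 := by
    intro β b V
    rw [Finset.sum_div]
    exact Finset.sum_congr rfl fun i _ => by ring
  simp only [hsum]
  exact div_le_div_of_nonneg_right hmono hL2.le

/-! ### §3 Along any tori: words certified on one thermal class hold on the other -/

/-- **A thermal FLOOR on the `κ`-hopping energy certified at the SOURCE holds at the TARGET.** `0 ≤ n ≤ 2`, `β_P < β_A`,
`β_A U_A = β_P U_P`, `κ = (β_A t'_A − β_P t'_P)/(β_A − β_P)`. If `ℓ ≤ e_{Φ(t,κ,0)}(ω_A)` for EVERY torus limit `ω_A` (along any tori) of the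
canonical sector Gibbs states of `H(t,t'_A,U_A)` at `(β_A, n)`, then `ℓ ≤ e_{Φ(t,κ,0)}(ω_P)` for every torus limit `ω_P` of the canonical
sector Gibbs states of `H(t,t'_P,U_P)` at `(β_P, n)`: extract a source limit along `ω_P`'s tori (`exists_isTorusLimitOfMixture_sectorGibbs`)
and compare along the common subsequence. Reading: a certified CEILING `−e_{Φ(t,κ,0)} ≤ −ℓ` (the shape of a stiffness word) flows from
the cooler, less coupled `A` to the hotter, more coupled `P` on the ray `βU = const`. [cite: Lieb1973, §V (5.2)–(5.4)] [cite: Ruelle1969, §2.5] -/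
theorem IsTorusLimitOfMixture.le_meanEnergy_apexHopping_of_forall_source_thermal (hn0 : 0 ≤ n) (hn2 : n ≤ 2)
    {βA βP UA UP : ℝ} (hβ : βP < βA) (hγ : βA * UA = βP * UP) (t'A t'P : ℝ) {ℓ : ℝ}
    (hℓ : ∀ (ωA : InfVolFermionState 2) (LsA : ℕ → ℕ), Tendsto LsA atTop atTop →
      ωA.IsTorusLimitOfMixture (sectorGibbsCount n) (fun L => sectorGibbsWeightTT' βA t t'A UA n L)
        (fun L => sectorGibbsVectorTT' t t'A UA n L) LsA →
      ℓ ≤ ωA.meanEnergy (hubbardTTPrimeFermionInteraction t ((βA * t'A - βP * t'P) / (βA - βP)) 0) 1)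
    {ωP : InfVolFermionState 2} {Ls : ℕ → ℕ}
    (hP : ωP.IsTorusLimitOfMixture (sectorGibbsCount n) (fun L => sectorGibbsWeightTT' βP t t'P UP n L)
      (fun L => sectorGibbsVectorTT' t t'P UP n L) Ls)
    (hLs : Tendsto Ls atTop atTop) :
    ℓ ≤ ωP.meanEnergy (hubbardTTPrimeFermionInteraction t ((βA * t'A - βP * t'P) / (βA - βP)) 0) 1 := by
  obtain ⟨φ, hφ, ωA, hA⟩ := exists_isTorusLimitOfMixture_sectorGibbs βA t t'A UA hn0 hn2 hLs
  have hLφ : Tendsto (Ls ∘ φ) atTop atTop := hLs.comp hφ.tendsto_atTop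
  exact (hℓ ωA (Ls ∘ φ) hLφ hA).trans
    (hA.meanEnergy_apexHopping_le_of_sectorGibbs_thermal hn0 hn2 hβ hγ t'A t'P (hP.comp_tendsto hφ.tendsto_atTop) hLφ)

/-- **A thermal CAP on the `κ`-hopping energy certified at the TARGET holds at the SOURCE** (the floor direction of the same row):
`e_{Φ(t,κ,0)}(ω_P) ≤ u` on the thermal class at `(β_P; t,t'_P,U_P, n)` ⇒ `e_{Φ(t,κ,0)}(ω_A) ≤ u` on the thermal class at `(β_A; t,t'_A,U_A, n)`.
[cite: Lieb1973, §V (5.2)–(5.4)] [cite: Ruelle1969, §2.5] -/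
theorem IsTorusLimitOfMixture.meanEnergy_apexHopping_le_of_forall_target_thermal (hn0 : 0 ≤ n) (hn2 : n ≤ 2)
    {βA βP UA UP : ℝ} (hβ : βP < βA) (hγ : βA * UA = βP * UP) (t'A t'P : ℝ) {u : ℝ}
    (hu : ∀ (ωP : InfVolFermionState 2) (LsP : ℕ → ℕ), Tendsto LsP atTop atTop →
      ωP.IsTorusLimitOfMixture (sectorGibbsCount n) (fun L => sectorGibbsWeightTT' βP t t'P UP n L)
        (fun L => sectorGibbsVectorTT' t t'P UP n L) LsP →
      ωP.meanEnergy (hubbardTTPrimeFermionInteraction t ((βA * t'A - βP * t'P) / (βA - βP)) 0) 1 ≤ u)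
    {ωA : InfVolFermionState 2} {Ls : ℕ → ℕ}
    (hA : ωA.IsTorusLimitOfMixture (sectorGibbsCount n) (fun L => sectorGibbsWeightTT' βA t t'A UA n L)
      (fun L => sectorGibbsVectorTT' t t'A UA n L) Ls)
    (hLs : Tendsto Ls atTop atTop) :
    ωA.meanEnergy (hubbardTTPrimeFermionInteraction t ((βA * t'A - βP * t'P) / (βA - βP)) 0) 1 ≤ u := by
  obtain ⟨φ, hφ, ωP, hP⟩ := exists_isTorusLimitOfMixture_sectorGibbs βP t t'P UP hn0 hn2 hLs
  have hLφ : Tendsto (Ls ∘ φ) atTop atTop := hLs.comp hφ.tendsto_atTop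
  exact ((hA.comp_tendsto hφ.tendsto_atTop).meanEnergy_apexHopping_le_of_sectorGibbs_thermal hn0 hn2 hβ hγ t'A t'P hP
    hLφ).trans (hu ωP (Ls ∘ φ) hLφ hP)

/-- **Doubled-hopping form** (the shape the f-sum stiffness word needs at the target): if `β_A t'_A = (2β_A − β_P) t'_P` then the apex hopping is
`2t'_P`, so a floor `ℓ ≤ e_{Φ(t,2t'_P,0)}` certified on the thermal class at `(β_A; t,t'_A,U_A, n)` holds on the thermal class at
`(β_P; t,t'_P,U_P, n)` (`β_P < β_A`, `β_A U_A = β_P U_P`). [cite: Lieb1973, §V (5.2)–(5.4)] [cite: KomaTasaki1994, §1] -/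
theorem IsTorusLimitOfMixture.le_meanEnergy_twice_tPrime_of_forall_source_thermal (hn0 : 0 ≤ n) (hn2 : n ≤ 2)
    {βA βP UA UP : ℝ} (hβ : βP < βA) (hγ : βA * UA = βP * UP) {t'A t'P : ℝ} (hapex : βA * t'A = (2 * βA - βP) * t'P) {ℓ : ℝ}
    (hℓ : ∀ (ωA : InfVolFermionState 2) (LsA : ℕ → ℕ), Tendsto LsA atTop atTop →
      ωA.IsTorusLimitOfMixture (sectorGibbsCount n) (fun L => sectorGibbsWeightTT' βA t t'A UA n L)
        (fun L => sectorGibbsVectorTT' t t'A UA n L) LsA →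
      ℓ ≤ ωA.meanEnergy (hubbardTTPrimeFermionInteraction t (2 * t'P) 0) 1)
    {ωP : InfVolFermionState 2} {Ls : ℕ → ℕ}
    (hP : ωP.IsTorusLimitOfMixture (sectorGibbsCount n) (fun L => sectorGibbsWeightTT' βP t t'P UP n L)
      (fun L => sectorGibbsVectorTT' t t'P UP n L) Ls)
    (hLs : Tendsto Ls atTop atTop) :
    ℓ ≤ ωP.meanEnergy (hubbardTTPrimeFermionInteraction t (2 * t'P) 0) 1 := by
  have hd : βA - βP ≠ 0 := sub_ne_zero.2 hβ.ne'
  have hκ : (βA * t'A - βP * t'P) / (βA - βP) = 2 * t'P := by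
    rw [div_eq_iff hd]; linarith
  have h := IsTorusLimitOfMixture.le_meanEnergy_apexHopping_of_forall_source_thermal (t := t) hn0 hn2 hβ hγ t'A t'P
    (ℓ := ℓ) (by rw [hκ]; exact hℓ) hP hLs
  rwa [hκ] at h

/-- **The `t' = 0` ray** (`κ = 0`, no hinge anywhere): a floor `ℓ ≤ e_{Φ(t,0,0)}` (kinetic energy per site) certified on the thermal class at
`(β_A; t, 0, U_A, n)` holds on the thermal class at `(β_P; t, 0, U_P, n)` whenever `β_P < β_A` and `β_A U_A = β_P U_P` — the kinetic word at
`(β, U)` is a word at every `(βU/U', U')`, `U' > U`. [cite: Lieb1973, §V (5.2)–(5.4)] [cite: KomaTasaki1994, §1] -/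
theorem IsTorusLimitOfMixture.le_meanEnergy_kinetic_tPrime_zero_of_forall_source_thermal (hn0 : 0 ≤ n) (hn2 : n ≤ 2)
    {βA βP UA UP : ℝ} (hβ : βP < βA) (hγ : βA * UA = βP * UP) {ℓ : ℝ}
    (hℓ : ∀ (ωA : InfVolFermionState 2) (LsA : ℕ → ℕ), Tendsto LsA atTop atTop →
      ωA.IsTorusLimitOfMixture (sectorGibbsCount n) (fun L => sectorGibbsWeightTT' βA t 0 UA n L)
        (fun L => sectorGibbsVectorTT' t 0 UA n L) LsA →
      ℓ ≤ ωA.meanEnergy (hubbardTTPrimeFermionInteraction t 0 0) 1)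
    {ωP : InfVolFermionState 2} {Ls : ℕ → ℕ}
    (hP : ωP.IsTorusLimitOfMixture (sectorGibbsCount n) (fun L => sectorGibbsWeightTT' βP t 0 UP n L)
      (fun L => sectorGibbsVectorTT' t 0 UP n L) Ls)
    (hLs : Tendsto Ls atTop atTop) :
    ℓ ≤ ωP.meanEnergy (hubbardTTPrimeFermionInteraction t 0 0) 1 := by
  have h := IsTorusLimitOfMixture.le_meanEnergy_twice_tPrime_of_forall_source_thermal (t := t) hn0 hn2 hβ hγ
    (t'A := 0) (t'P := 0) (by ring) (ℓ := ℓ) (by simpa only [mul_zero] using hℓ) hP hLs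
  simpa only [mul_zero] using h

end InfVolFermionState

end Literature.MathematicalPhysics.QuantumLattice

end
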